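import Summits.KontsevichZagierPeriods.KontsevichZagierPeriods.Theorems.SymplecticScissorsRealOnePeriodRelationsIsoLayer
import Summits.KontsevichZagierPeriods.KontsevichZagierPeriods.Theorems.RealOnePeriodRelations.Negative.Kit
import Summits.KontsevichZagierPeriods.KontsevichZagierPeriods.Theorems.RealOnePeriodRelations.Negative.GreenSound
import Summits.KontsevichZagierPeriods.KontsevichZagierPeriods.Theorems.FermatIsogenyBetaLinearSectorGreen
import Summits.KontsevichZagierPeriods.KontsevichZagierPeriods.Theorems.FermatIsogenyBetaLinearSectorStubFermatSymbolData
import Summits.KontsevichZagierPeriods.KontsevichZagierPeriods.Theorems.FermatIsogenyBetaLinearSectorStubFermatIntegrand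
import Summits.KontsevichZagierPeriods.KontsevichZagierPeriods.Theorems.FermatIsogenyBetaLinearSectorStubFermatRealise
import Literature.NumberTheory.Transcendental.CurvePeriodsGmLoopsProofs
import Literature.NumberTheory.Transcendental.CurvePeriodsStokesProofs
import Literature.NumberTheory.Transcendental.GammaMonomialsProofs
import Literature.NumberTheory.Transcendental.SemialgebraicAlgebraicPoints
import Literature.NumberTheory.Transcendental.KZCalculus
import HarnessLib

/-!
# `BetaLinearSector` (stmt-KontsevichZagierPeriods-3897), line `fermat-sector-transport` — stub
# `stub_rungOfArcRelation` (KZ: the TRANSFER from a two-term arc relation to the rung)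

`F_N = {x^N + y^N = 1}` is the affine Fermat curve, `ω_{r,s} = x^{r-1}y^{s-1}(y dx − x dy)` Rohrlich's polynomial form,
`γ_N(t) = Q(t)^{−1/N}(1−t, t)`, `Q = (1−t)^N + t^N`, the radial real arc from `(1,0)` to `(0,1)`.  For positive
`r, s, t` with `r + s + t = N` and a real algebraic `κ`, IF the two-term relation `(F_N, ω_{r,s}, γ_N) − κ (F_N, ω_{t,s}, γ_N)`
is an algebraic combination of the elementary relations (R1)–(R5) of `CurvePeriods`, THEN the pinned representations
`ρ = [x^{r/N−1}(1−x)^{s/N−1}]`, `ρ′ = [c·x^{t/N−1}(1−x)^{s/N−1}]` on `(0,1)` with equal values are KZ-equivalent.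

Proof (pattern `stub_betaArcs` / `fermatLayer` / `betaLinearSector_of_layer` of the skeleton, at the PRESCRIBED level
`N`): the landed sector glue `SectorGlue.realOnePeriodRelations_of_sector` with the two cells `{ρ, ρ′}` and the
TWO-SYMBOL sector `{(F_N, ω_{r,s}, γ_N), (F_N, ω_{t,s}, γ_N)}`.  Arcs: by the landed Fermat stubs (`stub_fermatSymbolData`,
`stub_fermatIntegrand`, `stub_fermatRealise`) and the landed real realisation `stub_realises`, each cell is modulo `M₁`
the realisation of ONE symbol (coefficient `−N`, resp. `−cN`) with the same value, so `−N·∫_{γ_N} ω_{r,s} = value ρ > 0`.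
Huber–Wüstholz ON THIS SECTOR is a theorem: the relation evaluates to `0` (Stokes), so `p₁ = κ p₂ ≠ 0` for the two
periods, and a vanishing algebraic combination `u·sy₁ + v·sy₂` has `v = −κu`, i.e. is `u` times the relation.  The
coefficient `c` IS algebraic (the integrand of `ρ′` is `ℚ`-semialgebraic: value at `x = 1/2`) and non-zero (equal
values).  Finally `[ρ] − [ρ′] ∈ M₁ ≤ KZ.relations` by the landed Green lemma `M₁_le_relations`.

References: A. Huber, G. Wüstholz, *Transcendence and Linear Relations of 1-Periods* (2022), Thm 13.3 (2), §3.3.1;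
M. Kontsevich, D. Zagier, *Periods* (2001), §1.2; B. Gross (appendix by D. Rohrlich), Invent. Math. 45 (1978), §1.
-/

noncomputable section

open scoped BigOperators unitInterval
open MeasureTheory Set MvPolynomial
open Literature.NumberTheory.Transcendental Literature.NumberTheory.Transcendental.CurvePeriods
open Summit.KontsevichZagierPeriods.SymplecticScissors.RealOnePeriodRelationsNegative (M₁ H₁ crux_iff
  eval_eq_zero_of_mem_M₁ measurableSet_unitDom volume_unitDom)
open Summit.KontsevichZagierPeriods.SymplecticScissors.RealOnePeriodRelations (Cells.combo_add Cells.combo_neg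
  Cells.combo_single stub_realises)
open Summit.KontsevichZagierPeriods.SymplecticScissors.RealOnePeriodRelations.RationalLayer (value_of_unitCell)

namespace Summit.KontsevichZagierPeriods.FermatIsogeny.BetaLinearSector

/-! ## Kit: values and coefficients of unit cells -/

/-- A one-dimensional representation on the unit interval whose integrand is positive on the domain has a
positive value (the integrand is integrable by definition and `(0,1)` has measure `1`). [folklore] -/
private theorem rung_value_pos (ρ : KZ.IntegralRep 1) (hd : ρ.domain = {x | x 0 ∈ Set.Ioo (0:ℝ) 1})
    (hpos : ∀ x ∈ ρ.domain, 0 < ρ.integrand x) : 0 < ρ.value := by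
  have hmeas : MeasurableSet ρ.domain := by rw [hd]; exact measurableSet_unitDom
  rw [KZ.IntegralRep.value, setIntegral_pos_iff_support_of_nonneg_ae ?_ ρ.integrableOn]
  · have hsupp : Function.support ρ.integrand ∩ ρ.domain = ρ.domain :=
      Set.inter_eq_right.2 fun x hx => (hpos x hx).ne'
    rw [hsupp, hd]
    show 0 < volume Summit.KontsevichZagierPeriods.SymplecticScissors.RealOnePeriodRelationsNegative.unitDom
    rw [volume_unitDom]
    exact one_pos
  · exact (ae_restrict_iff' hmeas).2 (Filter.Eventually.of_forall fun x hx => (hpos x hx).le)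

/-- `(1/2)^{t/N − 1}` is a real algebraic number (`N ≥ 1`): it is `2^{(N−t)/N}`, a rational power of `2`.
[folklore] -/
private theorem rung_isAlgebraic_half_rpow {N : ℕ} (hN : 1 ≤ N) (t : ℕ) :
    IsAlgebraic ℚ ((2:ℝ)⁻¹ ^ ((t:ℝ) / N - 1)) := by
  have hN0 : (N:ℝ) ≠ 0 := by exact_mod_cast (by omega : N ≠ 0)
  have h : (2:ℝ)⁻¹ ^ ((t:ℝ) / N - 1) = ((2:ℕ):ℝ) ^ (((((N:ℤ) - t : ℤ)) : ℝ) / (N:ℕ)) := by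
    rw [Real.inv_rpow (by norm_num : (0:ℝ) ≤ 2), ← Real.rpow_neg (by norm_num : (0:ℝ) ≤ 2)]
    push_cast
    congr 1
    field_simp
    ring
  rw [h]
  exact KoblitzOgus.isAlgebraic_nat_rpow_rat (by norm_num) _ (by omega)

/-- THE COEFFICIENT IS FORCED TO BE ALGEBRAIC: if a Kontsevich–Zagier representation on `(0,1)` has integrand
`c·x^{t/N−1}(1−x)^{s/N−1}` there, then `c` is algebraic — the integrand is a `ℚ`-semialgebraic function, so its
value at the rational point `1/2` is algebraic (`IsSemialgebraicFunOn.isAlgebraic_apply`), and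
`(1/2)^{t/N−1}(1/2)^{s/N−1}` is a non-zero algebraic number. [folklore] -/
private theorem rung_isAlgebraic_coeff {N s t : ℕ} (hN : 1 ≤ N) {c : ℝ} (ρ' : KZ.IntegralRep 1)
    (hd' : ρ'.domain = {x | x 0 ∈ Set.Ioo (0:ℝ) 1})
    (hi' : Set.EqOn ρ'.integrand (fun x => c * (x 0) ^ ((t:ℝ) / N - 1) * (1 - x 0) ^ ((s:ℝ) / N - 1))
      ρ'.domain) : IsAlgebraic ℚ c := by
  have hz₀ : (fun _ : Fin 1 => (2:ℝ)⁻¹) ∈ ρ'.domain := by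
    rw [hd']
    show (2:ℝ)⁻¹ ∈ Set.Ioo 0 1
    norm_num
  have halg := ρ'.isSemialgebraicFunOn_integrand.isAlgebraic_apply hz₀ (fun _ => (isAlgebraic_nat 2).inv)
  rw [hi' hz₀] at halg
  have h1 : IsAlgebraic ℚ ((2:ℝ)⁻¹ ^ ((t:ℝ) / N - 1)) := rung_isAlgebraic_half_rpow hN t
  have h2 : IsAlgebraic ℚ ((1 - (2:ℝ)⁻¹) ^ ((s:ℝ) / N - 1)) := by
    rw [show (1 - (2:ℝ)⁻¹) = 2⁻¹ by norm_num]
    exact rung_isAlgebraic_half_rpow hN s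
  have hw0 : (2:ℝ)⁻¹ ^ ((t:ℝ) / N - 1) * (1 - (2:ℝ)⁻¹) ^ ((s:ℝ) / N - 1) ≠ 0 :=
    (mul_pos (Real.rpow_pos_of_pos (by norm_num) _) (Real.rpow_pos_of_pos (by norm_num) _)).ne'
  have hc : c = c * (2:ℝ)⁻¹ ^ ((t:ℝ) / N - 1) * (1 - (2:ℝ)⁻¹) ^ ((s:ℝ) / N - 1) *
      ((2:ℝ)⁻¹ ^ ((t:ℝ) / N - 1) * (1 - (2:ℝ)⁻¹) ^ ((s:ℝ) / N - 1))⁻¹ := by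
    rw [mul_assoc c, mul_inv_cancel_right₀ hw0]
  rw [hc]
  exact halg.mul (h1.mul h2).inv

/-! ## One symbol: real realisation with value, and the arc data of the glue -/

/-- REALISATION WITH VALUE: if along the path of a symbol `sy` (semialgebraic as a real map) the form pulls back
on `(0,1)` to a REAL function `g`, then for a real algebraic `a` the landed real realisation `stub_realises` of
`a · sy` is a representation `R` on `(0,1)` with integrand `a · g`, and `a · ∫_γ ω = value R` (both are
`∫₀¹ a g`). [cite: HuberWustholz2022, §3.3.1] -/
theorem rungArc_realise (sy : PeriodSymbol)
    (hSA : IsSemialgebraicMapOn ℚ {z : Fin 1 → ℝ | z 0 ∈ Set.Icc (0 : ℝ) 1}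
      (fun z => Fin.append (fun i => (sy.γ.toFun (z 0) i).re) (fun i => (sy.γ.toFun (z 0) i).im)))
    (g : ℝ → ℝ) (hg : ∀ t ∈ Set.Ioo (0:ℝ) 1,
      (∑ i, MvPolynomial.eval (sy.γ.toFun t) (sy.ω i) * deriv (fun u => sy.γ.toFun u i) t) = ((g t : ℝ) : ℂ))
    (a : ℝ) (ha : IsAlgebraic ℚ a) :
    ∃ R : KZ.IntegralRep 1, R.domain = {z | z 0 ∈ Set.Ioo (0 : ℝ) 1} ∧
      (∀ z ∈ R.domain, R.integrand z =
        ((a : ℂ) * ∑ i, MvPolynomial.eval (sy.γ.toFun (z 0)) (sy.ω i) * deriv (fun u => sy.γ.toFun u i) (z 0)).re) ∧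
      (∀ z ∈ R.domain, R.integrand z = a * g (z 0)) ∧
      (a : ℂ) * sy.period = ((R.value : ℝ) : ℂ) := by
  obtain ⟨R, hRdom, hR⟩ := stub_realises sy.Z sy.γ hSA sy.ω sy.ω_algebraic (a : ℂ) ha.algebraMap
  have hmem : ∀ z : Fin 1 → ℝ, z ∈ R.domain → z 0 ∈ Set.Ioo (0:ℝ) 1 := fun z hz => by
    rw [hRdom] at hz; exact hz
  refine ⟨R, hRdom, hR, fun z hz => ?_, ?_⟩
  · rw [hR z hz, hg (z 0) (hmem z hz), ← Complex.ofReal_mul, Complex.ofReal_re]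
  · rw [PeriodSymbol.period, value_of_unitCell R hRdom, ← intervalIntegral.integral_ofReal,
      ← intervalIntegral.integral_const_mul, intervalIntegral.integral_of_le zero_le_one,
      intervalIntegral.integral_of_le zero_le_one, integral_Ioc_eq_integral_Ioo, integral_Ioc_eq_integral_Ioo]
    refine setIntegral_congr_fun measurableSet_Ioo fun t ht => ?_
    have hz : (fun _ : Fin 1 => t) ∈ R.domain := by rw [hRdom]; exact ht
    rw [hR _ hz]
    show (a : ℂ) * (∑ i, MvPolynomial.eval (sy.γ.toFun t) (sy.ω i) * deriv (fun u => sy.γ.toFun u i) t) = _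
    rw [hg t ht, ← Complex.ofReal_mul, Complex.ofReal_re]

/-- ONE-SYMBOL ARC DATA (the `harcs` input of `SectorGlue.realOnePeriodRelations_of_sector` for one cell): a cell `x`
realised modulo `M₁` by the real realisation `R` of `a · sy` (`a` algebraic, non-zero) with `a · ∫ sy = value x` gives
the combination `C = a · sy`, supported in any sector containing `sy`. [cite: KontsevichZagier2001, §1.2] -/
private theorem rung_single_arc (Ps : PeriodSymbol → Prop) {sy : PeriodSymbol} (hPs : Ps sy)
    (hSA : IsSemialgebraicMapOn ℚ {z : Fin 1 → ℝ | z 0 ∈ Set.Icc (0 : ℝ) 1}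
      (fun z => Fin.append (fun i => (sy.γ.toFun (z 0) i).re) (fun i => (sy.γ.toFun (z 0) i).im)))
    {a : ℂ} (ha : IsAlgebraic ℚ a) (ha0 : a ≠ 0) (x R : KZ.IntegralRep 1)
    (hR : R.domain = {z | z 0 ∈ Set.Ioo (0 : ℝ) 1} ∧ ∀ z ∈ R.domain, R.integrand z =
      (a * ∑ i, MvPolynomial.eval (sy.γ.toFun (z 0)) (sy.ω i) * deriv (fun u => sy.γ.toFun u i) (z 0)).re)
    (hval : a * sy.period = ((x.value : ℝ) : ℂ)) (hM : KZ.of x - KZ.of R ∈ M₁) :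
    ∃ (C : PeriodSymbol →₀ ℂ) (R : PeriodSymbol → KZ.IntegralRep 1), (∀ S, IsAlgebraic ℚ (C S)) ∧
      (∀ S ∈ C.support, Ps S) ∧
      (∀ S ∈ C.support, IsSemialgebraicMapOn ℚ {z : Fin 1 → ℝ | z 0 ∈ Set.Icc (0 : ℝ) 1}
        (fun z => Fin.append (fun i => (S.γ.toFun (z 0) i).re) (fun i => (S.γ.toFun (z 0) i).im))) ∧
      (∀ S ∈ C.support, (R S).domain = {z | z 0 ∈ Set.Ioo (0 : ℝ) 1} ∧ ∀ z ∈ (R S).domain, (R S).integrand z =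
        (C S * ∑ i, MvPolynomial.eval (S.γ.toFun (z 0)) (S.ω i) * deriv (fun u => S.γ.toFun u i) (z 0)).re) ∧
      evalCombination C = ((x.value : ℝ) : ℂ) ∧ KZ.of x - ∑ S ∈ C.support, KZ.of (R S) ∈ M₁ := by
  classical
  refine ⟨Finsupp.single sy a, fun _ => R, fun S => ?_, fun S hS => ?_, fun S hS => ?_, fun S hS => ?_, ?_, ?_⟩
  · rw [Finsupp.single_apply]
    split_ifs
    · exact ha
    · exact isAlgebraic_zero
  · rw [Finsupp.support_single _ ha0, Finset.mem_singleton] at hS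
    exact hS ▸ hPs
  · rw [Finsupp.support_single _ ha0, Finset.mem_singleton] at hS
    subst hS
    exact hSA
  · rw [Finsupp.support_single _ ha0, Finset.mem_singleton] at hS
    subst hS
    exact ⟨hR.1, fun z hz => by rw [hR.2 z hz, Finsupp.single_eq_same]⟩
  · rw [evalCombination_single, hval]
  · rw [Finsupp.support_single _ ha0, Finset.sum_singleton]
    exact hM

/-! ## The two-symbol sector glue -/

/-- **TRANSFER THROUGH THE TWO-SYMBOL SECTOR.**  Let `sy₁, sy₂` be period symbols along semialgebraic paths with
an elementary decomposition of `sy₁ − κ·sy₂` (`κ` real algebraic), and let `ρ, ρ′` be one-dimensional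
representations realised modulo `M₁` by `a₁·sy₁`, `a₂·sy₂` (`aᵢ` algebraic, non-zero; real realisations
`R₁, R₂` as produced by `stub_realises`) with `aᵢ·∫ syᵢ = value`, `value ρ ≠ 0` and `value ρ = value ρ′`.  Then
`ρ ∼ ρ′`: `SectorGlue.realOnePeriodRelations_of_sector` with `G = {[ρ], [ρ′]}` and the sector `{sy₁, sy₂}`, on
which Huber–Wüstholz 13.3 (2) HOLDS — the relation gives `p₁ = κ p₂` (Stokes) with `p₁ ≠ 0`, so a vanishing algebraic
combination `u·sy₁ + v·sy₂` has `v = −κu` and is `u·(sy₁ − κ sy₂)` — then `M₁ ≤ relations` (Green).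
[cite: HuberWustholz2022, Thm 13.3 (2)] [cite: KontsevichZagier2001, §1.2] -/
theorem equivalent_of_twoSymbolArcRelation {sy₁ sy₂ : PeriodSymbol} {κ : ℝ}
    (hspan : ∃ (k : ℕ) (ρl : Fin k → (PeriodSymbol →₀ ℂ)) (a : Fin k → ℂ),
        (∀ l, IsElementaryRelation (ρl l)) ∧ (∀ l, IsAlgebraic ℚ (a l)) ∧
        (Finsupp.single sy₁ (1 : ℂ) - (κ : ℂ) • Finsupp.single sy₂ (1 : ℂ)) = ∑ l, a l • ρl l)
    (hSA₁ : IsSemialgebraicMapOn ℚ {z : Fin 1 → ℝ | z 0 ∈ Set.Icc (0 : ℝ) 1}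
      (fun z => Fin.append (fun i => (sy₁.γ.toFun (z 0) i).re) (fun i => (sy₁.γ.toFun (z 0) i).im)))
    (hSA₂ : IsSemialgebraicMapOn ℚ {z : Fin 1 → ℝ | z 0 ∈ Set.Icc (0 : ℝ) 1}
      (fun z => Fin.append (fun i => (sy₂.γ.toFun (z 0) i).re) (fun i => (sy₂.γ.toFun (z 0) i).im)))
    {a₁ a₂ : ℂ} (ha₁ : IsAlgebraic ℚ a₁) (ha₂ : IsAlgebraic ℚ a₂) (ha₁0 : a₁ ≠ 0) (ha₂0 : a₂ ≠ 0)
    (ρ ρ' R₁ R₂ : KZ.IntegralRep 1)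
    (hR₁ : R₁.domain = {z | z 0 ∈ Set.Ioo (0 : ℝ) 1} ∧ ∀ z ∈ R₁.domain, R₁.integrand z =
      (a₁ * ∑ i, MvPolynomial.eval (sy₁.γ.toFun (z 0)) (sy₁.ω i) * deriv (fun u => sy₁.γ.toFun u i) (z 0)).re)
    (hR₂ : R₂.domain = {z | z 0 ∈ Set.Ioo (0 : ℝ) 1} ∧ ∀ z ∈ R₂.domain, R₂.integrand z =
      (a₂ * ∑ i, MvPolynomial.eval (sy₂.γ.toFun (z 0)) (sy₂.ω i) * deriv (fun u => sy₂.γ.toFun u i) (z 0)).re)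
    (hval₁ : a₁ * sy₁.period = ((ρ.value : ℝ) : ℂ)) (hval₂ : a₂ * sy₂.period = ((ρ'.value : ℝ) : ℂ))
    (hM₁ : KZ.of ρ - KZ.of R₁ ∈ M₁) (hM₂ : KZ.of ρ' - KZ.of R₂ ∈ M₁)
    (hρ0 : ρ.value ≠ 0) (hv : ρ.value = ρ'.value) : KZ.Equivalent ρ ρ' := by
  classical
  -- the two periods: `p₁ = κ p₂`, both non-zero
  have hp : sy₁.period = (κ : ℂ) * sy₂.period := by
    obtain ⟨k, ρl, a, hρl, -, hsum⟩ := hspan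
    have h0 := evalCombination_eq_zero_of_isElementaryRelation ρl a hρl
    rw [← hsum, sub_eq_add_neg, ← neg_smul, evalCombination_add, evalCombination_smul, evalCombination_single,
      evalCombination_single, one_mul, one_mul] at h0
    linear_combination h0
  have hp₁ : sy₁.period ≠ 0 := by
    intro h
    rw [h, mul_zero] at hval₁
    exact hρ0 (by exact_mod_cast hval₁.symm)
  have hp₂ : sy₂.period ≠ 0 := fun h => hp₁ (by rw [hp, h, mul_zero])
  -- Huber–Wüstholz ON THE TWO-SYMBOL SECTOR is a theorem
  have hHW : ∀ C : PeriodSymbol →₀ ℂ, (∀ S, IsAlgebraic ℚ (C S)) → (∀ S ∈ C.support, S = sy₁ ∨ S = sy₂) →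
      evalCombination C = 0 →
      ∃ (k : ℕ) (ρl : Fin k → (PeriodSymbol →₀ ℂ)) (a : Fin k → ℂ),
        (∀ l, IsElementaryRelation (ρl l)) ∧ (∀ l, IsAlgebraic ℚ (a l)) ∧ C = ∑ l, a l • ρl l := by
    intro C hCalg hCsupp hC0
    have hCzero : ∀ S, S ≠ sy₁ → S ≠ sy₂ → C S = 0 := fun S h1 h2 =>
      Finsupp.notMem_support_iff.1 fun hS => (hCsupp S hS).elim h1 h2
    by_cases hsy : sy₂ = sy₁
    · -- one symbol: `C = u·sy₁` and `u p₁ = 0`, so `C = 0`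
      have hC : C = C sy₁ • Finsupp.single sy₁ (1:ℂ) := by
        ext S
        rw [Finsupp.smul_apply, Finsupp.single_apply, smul_eq_mul]
        split_ifs with h
        · rw [← h, mul_one]
        · rw [mul_zero]
          exact hCzero S (Ne.symm h) (fun h' => h (hsy ▸ h'.symm))
      rw [hC, evalCombination_smul, evalCombination_single, one_mul] at hC0
      rw [hC, (mul_eq_zero.1 hC0).resolve_right hp₁, zero_smul]
      exact span_zero
    · -- two symbols: `C = u·sy₁ + v·sy₂` with `u p₁ + v p₂ = 0`, so `v = −κ u` and `C = u·(sy₁ − κ sy₂)`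
      have hC2 : C = C sy₁ • Finsupp.single sy₁ (1:ℂ) + C sy₂ • Finsupp.single sy₂ (1:ℂ) := by
        ext S
        simp only [Finsupp.add_apply, Finsupp.smul_apply, Finsupp.single_apply, smul_eq_mul]
        by_cases h1 : sy₁ = S
        · subst h1
          simp [hsy]
        · by_cases h2 : sy₂ = S
          · subst h2
            simp [h1]
          · simp [h1, h2, hCzero S (Ne.symm h1) (Ne.symm h2)]
      have hvu : C sy₂ = -(κ : ℂ) * C sy₁ := by
        rw [hC2, evalCombination_add, evalCombination_smul, evalCombination_smul, evalCombination_single,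
          evalCombination_single, one_mul, one_mul, hp] at hC0
        have h' : (C sy₁ * κ + C sy₂) * sy₂.period = 0 := by linear_combination hC0
        linear_combination (mul_eq_zero.1 h').resolve_right hp₂
      have hC : C = C sy₁ • (Finsupp.single sy₁ (1:ℂ) - (κ : ℂ) • Finsupp.single sy₂ (1:ℂ)) := by
        conv_lhs => rw [hC2, hvu]
        rw [smul_sub, smul_smul, neg_mul, neg_smul, mul_comm (κ : ℂ), sub_eq_add_neg]
      rw [hC]
      exact span_smul (hCalg sy₁) hspan
  -- cells: every element of the closure of `{[ρ], [ρ′]}` is a `ℤ`-combination of `ρ, ρ′`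
  have hcells : ∀ c : KZ.FormalRep,
      c ∈ AddSubgroup.closure ((fun x : KZ.IntegralRep 1 => KZ.of x) '' {x | x = ρ ∨ x = ρ'}) →
      ∃ N : KZ.IntegralRep 1 →₀ ℤ, (∀ x ∈ N.support, x = ρ ∨ x = ρ') ∧
        c - N.sum (fun x m => m • KZ.of x) ∈ M₁ := by
    intro c hc
    refine AddSubgroup.closure_induction (p := fun c _ => ∃ N : KZ.IntegralRep 1 →₀ ℤ,
        (∀ x ∈ N.support, x = ρ ∨ x = ρ') ∧ c - N.sum (fun x m => m • KZ.of x) ∈ M₁) ?_ ?_ ?_ ?_ hc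
    · rintro _ ⟨r, hr, rfl⟩
      refine ⟨Finsupp.single r 1, fun x hx => ?_, ?_⟩
      · rw [Finsupp.support_single _ one_ne_zero, Finset.mem_singleton] at hx
        exact hx ▸ hr
      · rw [Cells.combo_single, sub_self]
        exact M₁.zero_mem
    · exact ⟨0, by simp, by simp [M₁.zero_mem]⟩
    · rintro c c' _ _ ⟨N, hN, hcN⟩ ⟨N', hN', hcN'⟩
      refine ⟨N + N', fun x hx => ?_, ?_⟩
      · rcases Finset.mem_union.mp (Finsupp.support_add hx) with h | h
        · exact hN x h
        · exact hN' x h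
      · rw [Cells.combo_add]
        convert M₁.add_mem hcN hcN' using 1
        abel
    · rintro c _ ⟨N, hN, hcN⟩
      refine ⟨-N, fun x hx => hN x (by simpa [Finsupp.support_neg] using hx), ?_⟩
      rw [Cells.combo_neg]
      convert M₁.neg_mem hcN using 1
      abel
  -- glue (arcs: `rung_single_arc` for each cell), then Green
  have hmem : KZ.of ρ - KZ.of ρ' ∈
      AddSubgroup.closure ((fun x : KZ.IntegralRep 1 => KZ.of x) '' {x | x = ρ ∨ x = ρ'}) :=
    AddSubgroup.sub_mem _ (AddSubgroup.subset_closure ⟨ρ, Or.inl rfl, rfl⟩)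
      (AddSubgroup.subset_closure ⟨ρ', Or.inr rfl, rfl⟩)
  have heval : KZ.eval (KZ.of ρ - KZ.of ρ') = 0 := by
    rw [map_sub, KZ.eval_of, KZ.eval_of, hv, sub_self]
  refine M₁_le_relations
    (Summit.KontsevichZagierPeriods.SymplecticScissors.RealOnePeriodRelations.SectorGlue.realOnePeriodRelations_of_sector
      ((fun x : KZ.IntegralRep 1 => KZ.of x) '' {x | x = ρ ∨ x = ρ'}) (fun x => x = ρ ∨ x = ρ')
      (fun S => S = sy₁ ∨ S = sy₂) hHW hcells (fun x hx => ?_) _ hmem heval)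
  rcases hx with rfl | rfl
  · exact rung_single_arc _ (Or.inl rfl) hSA₁ ha₁ ha₁0 x R₁ hR₁ hval₁ hM₁
  · exact rung_single_arc _ (Or.inr rfl) hSA₂ ha₂ ha₂0 x R₂ hR₂ hval₂ hM₂

/-! ## The stub -/

/-- SECTOR STUB KZ (transfer: a two-term arc relation ⇒ the rung). If for positive `r, s, t` with `r + s + t = N`
and a real algebraic `κ` the two-term symbol relation `(F_N, ω_{r,s}, γ_N) − κ (F_N, ω_{t,s}, γ_N) ∼ 0` holds
(elementary decomposition), then Conjecture 1 holds for the pair of cells `[x^{r/N−1}(1−x)^{s/N−1}]`,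
`[c·x^{t/N−1}(1−x)^{s/N−1}]` on `(0,1)` with equal values: `SectorGlue.realOnePeriodRelations_of_sector` with the
two-symbol sector `{(F_N, ω_{r,s}, γ_N), (F_N, ω_{t,s}, γ_N)}` (its Huber–Wüstholz hypothesis follows from the
relation and `period ≠ 0`: a vanishing algebraic combination of the two symbols is a multiple of the relation),
cells ↔ symbols by the landed `stub_fermatSymbolData/Integrand/Realise` + `stub_realises` at the prescribed level
`N` (pattern `stub_betaArcs`), and `M₁ ≤ relations` (landed Green lemma). The constant `c` is algebraic because the
integrand of a representation is `ℚ`-semialgebraic, and non-zero because the values agree (it is forced to be `κ`).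
[cite: HuberWustholz2022, Thm 13.3 (2)] [cite: KontsevichZagier2001, §1.2] -/
theorem stub_rungOfArcRelation : ∀ (N r s t : ℕ), 1 ≤ r → 1 ≤ s → 1 ≤ t → r + s + t = N → ∀ (κ : ℝ), IsAlgebraic ℚ κ →
    (∀ (hZ : (⟨2, 1, ![X 0 ^ N + X 1 ^ N - 1]⟩ : CurveData).IsSmoothAffineCurve)
      (hω : ∀ i, HasAlgCoeffs ((![X 0 ^ (r - 1) * X 1 ^ s, -(X 0 ^ r * X 1 ^ (s - 1))] :
        Fin 2 → MvPolynomial (Fin 2) ℂ) i))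
      (hω' : ∀ i, HasAlgCoeffs ((![X 0 ^ (t - 1) * X 1 ^ s, -(X 0 ^ t * X 1 ^ (s - 1))] :
        Fin 2 → MvPolynomial (Fin 2) ℂ) i))
      (γ : CurvePath (⟨2, 1, ![X 0 ^ N + X 1 ^ N - 1]⟩ : CurveData)),
      (∀ u : ℝ, γ.toFun u = ![(((1 - u) * ((1 - u) ^ N + u ^ N) ^ (-(1:ℝ) / N) : ℝ) : ℂ),
        ((u * ((1 - u) ^ N + u ^ N) ^ (-(1:ℝ) / N) : ℝ) : ℂ)]) →
      ∃ (k : ℕ) (ρ : Fin k → (PeriodSymbol →₀ ℂ)) (a : Fin k → ℂ),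
        (∀ l, IsElementaryRelation (ρ l)) ∧ (∀ l, IsAlgebraic ℚ (a l)) ∧
        (Finsupp.single (⟨(⟨2, 1, ![X 0 ^ N + X 1 ^ N - 1]⟩ : CurveData), hZ,
              (![X 0 ^ (r - 1) * X 1 ^ s, -(X 0 ^ r * X 1 ^ (s - 1))] : Fin 2 → MvPolynomial (Fin 2) ℂ), hω, γ⟩ :
              PeriodSymbol) (1 : ℂ) -
            (κ : ℂ) • Finsupp.single (⟨(⟨2, 1, ![X 0 ^ N + X 1 ^ N - 1]⟩ : CurveData), hZ,
              (![X 0 ^ (t - 1) * X 1 ^ s, -(X 0 ^ t * X 1 ^ (s - 1))] : Fin 2 → MvPolynomial (Fin 2) ℂ), hω', γ⟩ :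
              PeriodSymbol) (1 : ℂ)) =
          ∑ l, a l • ρ l) →
    ∀ (c : ℝ) (ρ ρ' : KZ.IntegralRep 1),
      ρ.domain = {x | x 0 ∈ Set.Ioo (0:ℝ) 1} →
      Set.EqOn ρ.integrand (fun x => (x 0) ^ ((r:ℝ) / N - 1) * (1 - x 0) ^ ((s:ℝ) / N - 1)) ρ.domain →
      ρ'.domain = {x | x 0 ∈ Set.Ioo (0:ℝ) 1} →
      Set.EqOn ρ'.integrand (fun x => c * (x 0) ^ ((t:ℝ) / N - 1) * (1 - x 0) ^ ((s:ℝ) / N - 1)) ρ'.domain →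
      ρ.value = ρ'.value → KZ.Equivalent ρ ρ' := by
  intro N r s t hr hs ht hrst κ _hκ hrel c ρ ρ' hd hi hd' hi' hv
  have hN : 1 ≤ N := by omega
  have hN0 : (N:ℝ) ≠ 0 := by exact_mod_cast (by omega : N ≠ 0)
  -- symbol data at the prescribed level `N`, and the two-term relation instantiated
  obtain ⟨hZ, γ, hγ, hSA⟩ := stub_fermatSymbolData N hN
  have hωof : ∀ r s : ℕ, ∀ i, HasAlgCoeffs ((![X 0 ^ (r - 1) * X 1 ^ s, -(X 0 ^ r * X 1 ^ (s - 1))] :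
      Fin 2 → MvPolynomial (Fin 2) ℂ) i) := by
    intro r s i
    fin_cases i
    · exact ((hasAlgCoeffs_X 0).pow (r - 1)).mul ((hasAlgCoeffs_X 1).pow s)
    · exact (((hasAlgCoeffs_X 0).pow r).mul ((hasAlgCoeffs_X 1).pow (s - 1))).neg
  have hspan := hrel hZ (hωof r s) (hωof t s) γ hγ
  -- the value of `ρ` is positive; `c` is algebraic and non-zero
  have hρpos : 0 < ρ.value := by
    refine rung_value_pos ρ hd fun x hx => ?_
    have hx' : x 0 ∈ Set.Ioo (0:ℝ) 1 := by rw [hd] at hx; exact hx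
    rw [hi hx]
    exact mul_pos (Real.rpow_pos_of_pos hx'.1 _) (Real.rpow_pos_of_pos (sub_pos.2 hx'.2) _)
  have hc : IsAlgebraic ℚ c := rung_isAlgebraic_coeff hN ρ' hd' hi'
  have hc0 : c ≠ 0 := by
    rintro rfl
    refine hρpos.ne' (hv.trans ?_)
    rw [KZ.IntegralRep.value]
    exact setIntegral_eq_zero_of_forall_eq_zero fun x hx => by rw [hi' hx]; simp
  -- the real realisations of the two symbols (coefficients `−N` and `−cN`)
  have hNalg : IsAlgebraic ℚ (N:ℝ) := isAlgebraic_nat N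
  obtain ⟨R₁, hR₁dom, hR₁, hR₁g, hR₁val⟩ := rungArc_realise
    ⟨(⟨2, 1, ![X 0 ^ N + X 1 ^ N - 1]⟩ : CurveData), hZ,
      (![X 0 ^ (r - 1) * X 1 ^ s, -(X 0 ^ r * X 1 ^ (s - 1))] : Fin 2 → MvPolynomial (Fin 2) ℂ), hωof r s, γ⟩
    hSA (fun u => -((1 - u) ^ (r - 1) * u ^ (s - 1) * ((1 - u) ^ N + u ^ N) ^ (-((r:ℝ) + s) / N)))
    (stub_fermatIntegrand N r s hN hr hs γ hγ) (-(N:ℝ)) hNalg.neg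
  obtain ⟨R₂, hR₂dom, hR₂, hR₂g, hR₂val⟩ := rungArc_realise
    ⟨(⟨2, 1, ![X 0 ^ N + X 1 ^ N - 1]⟩ : CurveData), hZ,
      (![X 0 ^ (t - 1) * X 1 ^ s, -(X 0 ^ t * X 1 ^ (s - 1))] : Fin 2 → MvPolynomial (Fin 2) ℂ), hωof t s, γ⟩
    hSA (fun u => -((1 - u) ^ (t - 1) * u ^ (s - 1) * ((1 - u) ^ N + u ^ N) ^ (-((t:ℝ) + s) / N)))
    (stub_fermatIntegrand N t s hN ht hs γ hγ) (-(c * N)) (hc.mul hNalg).neg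
  -- rule 2 along the Fermat chart: `[ρ] − [R₁] ∈ M₁`, `[ρ′] − [R₂] ∈ M₁`; hence equal values
  have hM₁ : KZ.of ρ - KZ.of R₁ ∈ M₁ := by
    refine stub_fermatRealise N r s 1 hN hr hs isAlgebraic_one ρ R₁ hd (fun z hz => ?_) hR₁dom (fun z hz => ?_)
    · rw [hi hz]
      simp only [one_mul]
    · rw [hR₁g z hz]
      ring
  have hM₂ : KZ.of ρ' - KZ.of R₂ ∈ M₁ := by
    refine stub_fermatRealise N t s c hN ht hs hc ρ' R₂ hd' hi' hR₂dom (fun z hz => ?_)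
    rw [hR₂g z hz]
    ring
  have hv₁ : ρ.value = R₁.value := sub_eq_zero.1 (by simpa using eval_eq_zero_of_mem_M₁ hM₁)
  have hv₂ : ρ'.value = R₂.value := sub_eq_zero.1 (by simpa using eval_eq_zero_of_mem_M₁ hM₂)
  rw [← hv₁] at hR₁val
  rw [← hv₂] at hR₂val
  -- the transfer
  have ha₁0 : (((-(N:ℝ)) : ℝ) : ℂ) ≠ 0 := by
    rw [Ne, Complex.ofReal_eq_zero, neg_eq_zero]
    exact hN0
  have ha₂0 : (((-(c * N)) : ℝ) : ℂ) ≠ 0 := by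
    rw [Ne, Complex.ofReal_eq_zero, neg_eq_zero, mul_eq_zero, not_or]
    exact ⟨hc0, hN0⟩
  have ha₁ : IsAlgebraic ℚ (((-(N:ℝ)) : ℝ) : ℂ) := hNalg.neg.algebraMap
  have ha₂ : IsAlgebraic ℚ (((-(c * N)) : ℝ) : ℂ) := (hc.mul hNalg).neg.algebraMap
  exact equivalent_of_twoSymbolArcRelation hspan hSA hSA ha₁ ha₂ ha₁0 ha₂0 ρ ρ' R₁ R₂ ⟨hR₁dom, hR₁⟩ ⟨hR₂dom, hR₂⟩
    hR₁val hR₂val hM₁ hM₂ hρpos.ne' hv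

end Summit.KontsevichZagierPeriods.FermatIsogeny.BetaLinearSector

end
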